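import Summits.AtomisticToContinuum.Crystallization.Theses.GappedShellCensus
import Literature.Probability.Process.LocalRubberCompact
import Literature.Probability.Process.LocalRubberHardCore
import Literature.MathematicalPhysics.StatisticalMechanics.BallMatchLocallyMatches
import Literature.MathematicalPhysics.StatisticalMechanics.LocalMatchingCompactness
import Summits.AtomisticToContinuum.Crystallization.Theorems.PalmUnimodularRigidityChargedPatternCrystallizes

/-!
# Candidate proof (Line A, `rationing-splice`) of the crux
# `GappedShellCensus.CleanLimitExtractionR` (stmt-AtomisticToContinuum-18072)

`theorem cleanLimitExtractionR_candidateA : CleanLimitExtractionR` — crux-ideate r1, ideator 1.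
This file is ideator 2's COMPLETE pre-repair workfile `Cruxes/CleanLimitExtraction/SketchIdeator2.lean`
(stmt-15933; hull as ω-limit, collar transfer, typed closedness, counting, `cleanLimitExtraction_via_hull :
GappedRationing → RadialDefectsVanish → CleanLocalLimit`) COPIED VERBATIM with exactly two declarations removed — the
census step `gappedRationing_of_census` and `cleanLimitExtraction_sketch`, the only ones mentioning the decls
`ShellCensus` / `CleanLimitExtraction` dropped from the route file at rev 5 — and this seat's SPLICE appended (§ Splice):
`gappedRationing_of_trichotomy : ShellTrichotomy → TornFree → FiveFoldRationingR → GappedRationing` via the degree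
dictionary `shellDegree_eq_commonNbrs`, then the crux by name.
-/

noncomputable section

open Filter Topology Set
open scoped omegaLimit

namespace Summit.AtomisticToContinuum.Crystallization.Cruxes.CleanLimitExtractionR.CandidateA

open Literature.Probability.Process Literature.MathematicalPhysics.StatisticalMechanics
  Literature.Geometry.DiscreteGeometry
open Summit.AtomisticToContinuum.Crystallization.Theses.GappedShellCensus

/-- Euclidean 3-space. -/
abbrev E3 := EuclideanSpace ℝ (Fin 3)

/-! ## The route's inlined site predicates, named -/

/-- GAPPED-TWELVE at scale `a` (literally the route's clause for a site `y` of `Y`). -/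
def GappedTwelve (a : ℝ) (Y : Set E3) (y : E3) : Prop :=
  {w ∈ Y | w ≠ y ∧ dist y w ≤ a * (1 + 1 / 50)}.ncard = 12 ∧
    ∀ w ∈ Y, w ≠ y → a * (1 - 1 / 50) ≤ dist y w ∧
      (dist y w ≤ a * (1 + 1 / 50) ∨ a * (63 / 50) ≤ dist y w)

/-- The rescaled bond shell of `y` is `1/5`-close to fcc or hcp (the route's typing clause). -/
def FccHcpShell (a : ℝ) (Y : Set E3) (y : E3) : Prop :=
  ∃ T : Finset E3, (↑T : Set E3) = (fun w => a⁻¹ • (w - y)) '' {w ∈ Y | w ≠ y ∧ dist y w ≤ a * (1 + 1 / 50)} ∧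
    (ShellCloseTo (1 / 5) T fccKissingPattern ∨ ShellCloseTo (1 / 5) T hcpKissingPattern)

/-- CLEAN site = gapped-twelve with fcc/hcp-close shell (the conjunct of `CleanLocalLimit`). -/
def CleanSite (a : ℝ) (Y : Set E3) (y : E3) : Prop :=
  GappedTwelve a Y y ∧ FccHcpShell a Y y

/-- The ALPHABET-FREE rationing (FiveFoldRationing with its typing hypothesis discharged by the
census; the refuter's `GappedRationing`, restated here since Helper.lean is not importable):
an all-gapped-twelve non-empty `Y` has fcc/hcp-clean balls of every radius. -/
def GappedRationing : Prop :=
  ∀ (Y : Set E3) (a : ℝ), 0 < a → Y.Nonempty → (∀ y ∈ Y, GappedTwelve a Y y) →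
    ∀ R : ℝ, ∃ c ∈ Y, ∀ y ∈ Y, dist y c ≤ R → FccHcpShell a Y y

/-! ## Card A — the hull as a Mathlib ω-limit set in the compact rubber space `LocalConfig E3` -/

/-- The `N`-th cluster as a point configuration. -/
def cfg (x : (N : ℕ) → (Fin N → E3)) (N : ℕ) : LocalConfig E3 := ⟨Set.range (x N)⟩

/-- The HULL of a sequence of finite configurations: the ω-limit, as the particle number
`N → ∞` (`Filter.atTop`), of the family of ALL re-rootings `(cfg x N).translate t`, `t ∈ ℝ³`, in
the compact pseudometric space `LocalConfig E3` of the local rubber topology: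
`hull x = ⋂_{N₀} closure {(cfg x N).translate t | N ≥ N₀, t}`. -/
def hull (x : (N : ℕ) → (Fin N → E3)) : Set (LocalConfig E3) :=
  ω atTop (fun N (t : E3) => (cfg x N).translate t) univ

variable {x : (N : ℕ) → (Fin N → E3)} {Y : LocalConfig E3}

/-- The hull is closed — Mathlib `isClosed_omegaLimit`. PROVED. -/
theorem isClosed_hull (x : (N : ℕ) → (Fin N → E3)) : IsClosed (hull x) :=
  isClosed_omegaLimit _ _ _

/-- The hull is invariant under re-rooting — Mathlib `mapsTo_omegaLimit` with the continuous map
`translate · y` (`LocalConfig.continuous_translate`) and `translate_translate`. PROVED: this and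
`isClosed_hull` REPLACE the diagonal argument (closure of the orbit of a hull element ⊆ hull). -/
theorem translate_mem_hull (hY : Y ∈ hull x) (y : E3) : Y.translate y ∈ hull x := by
  have h := mapsTo_omegaLimit (f := atTop) (ϕ := fun N (t : E3) => (cfg x N).translate t)
    (ϕ' := fun N (t : E3) => (cfg x N).translate t) (s := univ) (s' := univ)
    (ga := fun t => y + t) (mapsTo_univ _ _) (gb := fun S : LocalConfig E3 => S.translate y)
    (fun N t => LocalConfig.translate_translate _ _ _) (LocalConfig.continuous_translate y)
  exact h hY

/-- Closure of the re-rooting orbit of a hull element stays in the hull (corollary; no indices). -/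
theorem closure_orbit_subset_hull (hY : Y ∈ hull x) :
    closure (Set.range fun y : E3 => Y.translate y) ⊆ hull x :=
  closure_minimal (by rintro _ ⟨y, rfl⟩; exact translate_mem_hull hY y) (isClosed_hull x)

/-- Limits of re-rooted clusters along a subsequence lie in the hull (definition of `ω`). PROVED. -/
theorem mem_hull_of_tendsto {φ : ℕ → ℕ} (hφ : StrictMono φ) (t : ℕ → E3)
    (h : Tendsto (fun k => (cfg x (φ k)).translate (t k)) atTop (𝓝 Y)) : Y ∈ hull x := by
  simp only [hull, omegaLimit_def, mem_iInter]
  intro u hu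
  refine mem_closure_of_tendsto h ?_
  have hev : ∀ᶠ k in atTop, φ k ∈ u := hφ.tendsto_atTop.eventually hu
  filter_upwards [hev] with k hk
  exact mem_image2_of_mem hk (mem_univ _)

/-- DICTIONARY, sequential form (FIRST LEMMA of card A): a member of the hull is the limit of
re-rooted clusters along a STRICTLY INCREASING subsequence of THE GIVEN `x`
(`mem_omegaLimit_iff_frequently` + metric balls + `Filter.extraction_forall_of_frequently`). PROVED. -/
theorem exists_seq_of_mem_hull (hY : Y ∈ hull x) :
    ∃ (φ : ℕ → ℕ) (t : ℕ → E3), StrictMono φ ∧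
      Tendsto (fun k => (cfg x (φ k)).translate (t k)) atTop (𝓝 Y) := by
  have hfr : ∀ k : ℕ, ∃ᶠ N in atTop, ∃ t : E3,
      dist ((cfg x N).translate t) Y < 1 / ((k : ℝ) + 1) := by
    intro k
    have h := (mem_omegaLimit_iff_frequently _ _ _ Y).1 hY (Metric.ball Y (1 / ((k : ℝ) + 1)))
      (Metric.ball_mem_nhds _ (by positivity))
    refine h.mono fun N hN => ?_
    obtain ⟨t, -, ht⟩ := hN
    exact ⟨t, Metric.mem_ball.1 ht⟩
  obtain ⟨φ, hφ, hP⟩ := extraction_forall_of_frequently hfr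
  choose t ht using hP
  refine ⟨φ, t, hφ, ?_⟩
  rw [Metric.tendsto_atTop]
  intro ε hε
  obtain ⟨K, hK⟩ := exists_nat_one_div_lt hε
  refine ⟨K, fun k hk => lt_of_lt_of_le (ht k) ?_⟩
  have hk' : (K : ℝ) + 1 ≤ (k : ℝ) + 1 := by
    have : (K : ℝ) ≤ k := by exact_mod_cast hk
    linarith
  have : (1 : ℝ) / ((k : ℝ) + 1) ≤ 1 / ((K : ℝ) + 1) :=
    one_div_le_one_div_of_le (by positivity) hk'
  linarith

/-- DICTIONARY, matching form: convergence of re-rooted clusters IS the two-way matching clause of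
`CleanLocalLimit` (`LocalConfig.tendsto_iff_locallyMatches`; translation `τ n = -t n`). PROVED. -/
theorem cll_clause_of_tendsto {φ : ℕ → ℕ} {t : ℕ → E3}
    (h : Tendsto (fun k => (cfg x (φ k)).translate (t k)) atTop (𝓝 Y)) :
    ∀ R ε : ℝ, 0 < ε → ∀ᶠ n in atTop,
      (∀ y ∈ (Y : Set E3), ‖y‖ ≤ R → ∃ i : Fin (φ n), dist (x (φ n) i + -t n) y ≤ ε) ∧
      (∀ i : Fin (φ n), ‖x (φ n) i + -t n‖ ≤ R →
        ∃ y ∈ (Y : Set E3), dist (x (φ n) i + -t n) y ≤ ε) := by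
  intro R ε hε
  filter_upwards [LocalConfig.tendsto_iff_locallyMatches.1 h R ε hε] with n hn
  obtain ⟨h1, h2⟩ := hn
  have hmem : ∀ i : Fin (φ n), x (φ n) i + -t n ∈ ((cfg x (φ n)).translate (t n) : Set E3) := by
    intro i
    simp only [cfg, LocalConfig.coe_translate, LocalConfig.coe_mk]
    exact ⟨x (φ n) i, ⟨i, rfl⟩, sub_eq_add_neg _ _⟩
  refine ⟨fun y hy hyR => ?_, fun i hi => ?_⟩
  · obtain ⟨p, hp, hyp⟩ := h2 y hy hyR
    simp only [cfg, LocalConfig.coe_translate, LocalConfig.coe_mk] at hp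
    obtain ⟨z, ⟨i, rfl⟩, rfl⟩ := hp
    exact ⟨i, by rw [← sub_eq_add_neg, dist_comm]; exact hyp⟩
  · obtain ⟨q, hq, hqp⟩ := h1 (x (φ n) i + -t n) (hmem i) hi
    exact ⟨q, hq, by rw [dist_comm]; exact hqp⟩

/- (The crux-level statements `exists_clean_rooted_mem_hull`, `cleanLimitExtraction_via_hull`,
`cleanLimitExtraction_sketch` of card A are at the END of the file, after the closedness lemmas
they use.) -/

/-! ## Card C — the Hales gap makes shell counts continuous: collar transfer -/

/-- FIRST LEMMA of card C: COLLAR TRANSFER (finite, limit-free). Two `δ`-separated configurations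
that are two-way `(R, η)`-matched with `2η < δ` have the SAME gapped-twelve status at matched sites,
provided the second one is radially admissible there: the matching restricts to a bijection of the
two bond shells because their boundary spheres `0.98a`, `1.02a` sit inside particle-free collars
(the hard-core moat below `0.98a` and the Hales gap `(1.02a, 1.26a)`), both wider than `2η`.
PROVED. -/
theorem gappedTwelve_transfer {S S' : Set E3} {a δ η R : ℝ} (ha : 0 < a) (hδ : 0 < δ)
    (hη : 0 ≤ η) (h2η : 2 * η < δ) (hηa : 25 * η < a)
    (hS : ∀ u ∈ S, ∀ v ∈ S, u ≠ v → δ ≤ dist u v)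
    (hS' : ∀ u ∈ S', ∀ v ∈ S', u ≠ v → δ ≤ dist u v)
    (hm : LocallyMatches R η S S') {p p' : E3} (hp : p ∈ S) (hp' : p' ∈ S')
    (hpp' : dist p p' ≤ η) (hR : ‖p‖ + 2 * a ≤ R)
    (hg : GappedTwelve a S p)
    (hrad : ∀ w ∈ S', w ≠ p' → a * (1 - 1 / 50) ≤ dist p' w ∧
      (dist p' w ≤ a * (1 + 1 / 50) ∨ a * (63 / 50) ≤ dist p' w)) :
    GappedTwelve a S' p' := by
  obtain ⟨hcount, hradS⟩ := hg
  refine ⟨?_, hrad⟩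
  set A : Set E3 := {w ∈ S | w ≠ p ∧ dist p w ≤ a * (1 + 1 / 50)} with hA
  set B : Set E3 := {w ∈ S' | w ≠ p' ∧ dist p' w ≤ a * (1 + 1 / 50)} with hB
  -- both shells are finite (separated subsets of closed balls)
  have hAfin : A.Finite := by
    refine finite_of_forall_le_dist_of_subset_closedBall hδ
      (fun u hu v hv huv => hS u hu.1 v hv.1 huv) (c := p) (R := a * (1 + 1 / 50)) ?_
    intro w hw
    exact Metric.mem_closedBall.2 (by rw [dist_comm]; exact hw.2.2)
  have hBfin : B.Finite := by
    refine finite_of_forall_le_dist_of_subset_closedBall hδ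
      (fun u hu v hv huv => hS' u hu.1 v hv.1 huv) (c := p') (R := a * (1 + 1 / 50)) ?_
    intro w hw
    exact Metric.mem_closedBall.2 (by rw [dist_comm]; exact hw.2.2)
  have hpp'' : dist p' p ≤ η := by rw [dist_comm]; exact hpp'
  -- shell of `p` in `S` ↦ shell of `p'` in `S'`
  have hAto : ∀ w ∈ A, ∃ w' ∈ B, dist w w' ≤ η := by
    intro w hw
    obtain ⟨hwS, hwp, hdw⟩ := hw
    have hwR : ‖w‖ ≤ R := by
      have h1 := norm_sub_norm_le w p
      rw [← dist_eq_norm, dist_comm] at h1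
      nlinarith [ha]
    obtain ⟨w', hw'S, hww'⟩ := hm.2 w hwS hwR
    have hlow : a * (1 - 1 / 50) ≤ dist p w := (hradS w hwS hwp).1
    have hne : w' ≠ p' := by
      intro h
      rw [h] at hww'
      have : dist p w ≤ dist p p' + dist w p' := dist_triangle_right p w p'
      nlinarith [ha]
    have hup : dist p' w' ≤ a * (1 + 1 / 50) + 2 * η :=
      calc dist p' w' ≤ dist p' p + dist p w' := dist_triangle _ _ _
        _ ≤ dist p' p + (dist p w + dist w w') := by gcongr; exact dist_triangle _ _ _
        _ ≤ η + (a * (1 + 1 / 50) + η) := by gcongr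
        _ = a * (1 + 1 / 50) + 2 * η := by ring
    refine ⟨w', ⟨hw'S, hne, ?_⟩, hww'⟩
    rcases (hrad w' hw'S hne).2 with h | h
    · exact h
    · exfalso; nlinarith [ha]
  -- shell of `p'` in `S'` ↦ shell of `p` in `S`
  have hBto : ∀ w' ∈ B, ∃ w ∈ A, dist w w' ≤ η := by
    intro w' hw'
    obtain ⟨hw'S, hw'p, hdw'⟩ := hw'
    have hw'R : ‖w'‖ ≤ R := by
      have h1 := norm_sub_norm_le w' p'
      rw [← dist_eq_norm, dist_comm] at h1
      have h2 := norm_sub_norm_le p' p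
      rw [← dist_eq_norm] at h2
      nlinarith [ha]
    obtain ⟨w, hwS, hww'⟩ := hm.1 w' hw'S hw'R
    have hlow : a * (1 - 1 / 50) ≤ dist p' w' := (hrad w' hw'S hw'p).1
    have hne : w ≠ p := by
      intro h
      rw [h] at hww'
      have : dist p' w' ≤ dist p' p + dist p w' := dist_triangle _ _ _
      nlinarith [ha]
    have hup : dist p w ≤ a * (1 + 1 / 50) + 2 * η :=
      calc dist p w ≤ dist p p' + dist p' w := dist_triangle _ _ _
        _ ≤ dist p p' + (dist p' w' + dist w' w) := by gcongr; exact dist_triangle _ _ _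
        _ ≤ η + (a * (1 + 1 / 50) + η) := by gcongr; rw [dist_comm]; exact hww'
        _ = a * (1 + 1 / 50) + 2 * η := by ring
    refine ⟨w, ⟨hwS, hne, ?_⟩, hww'⟩
    rcases (hradS w hwS hne).2 with h | h
    · exact h
    · exfalso; nlinarith [ha]
  -- the two maps are injective because `2η < δ`
  choose! f hf using hAto
  choose! g hg using hBto
  have hfinj : Set.InjOn f A := by
    intro w₁ h₁ w₂ h₂ heq
    by_contra hne
    have hsep := hS w₁ h₁.1 w₂ h₂.1 hne
    have : dist w₁ w₂ ≤ 2 * η :=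
      calc dist w₁ w₂ ≤ dist w₁ (f w₁) + dist w₂ (f w₁) := dist_triangle_right _ _ _
        _ ≤ η + η := by
            gcongr
            · exact (hf w₁ h₁).2
            · rw [heq]; exact (hf w₂ h₂).2
        _ = 2 * η := by ring
    linarith
  have hginj : Set.InjOn g B := by
    intro w₁ h₁ w₂ h₂ heq
    by_contra hne
    have hsep := hS' w₁ h₁.1 w₂ h₂.1 hne
    have : dist w₁ w₂ ≤ 2 * η :=
      calc dist w₁ w₂ ≤ dist (g w₁) w₁ + dist (g w₁) w₂ := dist_triangle_left _ _ _
        _ ≤ η + η := by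
            gcongr
            · exact (hg w₁ h₁).2
            · rw [heq]; exact (hg w₂ h₂).2
        _ = 2 * η := by ring
    linarith
  have h1 : A.ncard ≤ B.ncard := Set.ncard_le_ncard_of_injOn f (fun w hw => (hf w hw).1) hfinj hBfin
  have h2 : B.ncard ≤ A.ncard := Set.ncard_le_ncard_of_injOn g (fun w hw => (hg w hw).1) hginj hAfin
  omega

/-- Radial admissibility is CLOSED along local-rubber limits (the allowed distance set
`{0} ∪ [0.98a, 1.02a] ∪ [1.26a, ∞)` is closed) — the cheap half. PROVED. -/
theorem radial_of_tendsto {S : ℕ → LocalConfig E3} {Y : LocalConfig E3} {a δ : ℝ} (ha : 0 < a)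
    (hδ : 0 < δ) (hS : ∀ k, ∀ u ∈ S k, ∀ v ∈ S k, u ≠ v → δ ≤ dist u v)
    (hY : Tendsto S atTop (𝓝 Y)) {y : E3} {r : ℝ} (hy : y ∈ Y) (hyr : ‖y‖ < r)
    (hgood : ∀ᶠ k in atTop, ∀ p ∈ S k, ‖p‖ ≤ r → GappedTwelve a (S k : Set E3) p) :
    ∀ w ∈ (Y : Set E3), w ≠ y → a * (1 - 1 / 50) ≤ dist y w ∧
      (dist y w ≤ a * (1 + 1 / 50) ∨ a * (63 / 50) ≤ dist y w) := by
  intro w hw hne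
  have hyw : 0 < dist y w := dist_pos.2 (Ne.symm hne)
  have hr : 0 < r - ‖y‖ := by linarith
  -- key approximation: at every small scale `η` the distance `dist y w` is `2η`-close to an admissible one
  have key : ∀ η : ℝ, 0 < η → η ≤ r - ‖y‖ → 2 * η < dist y w →
      ∃ d : ℝ, |d - dist y w| ≤ 2 * η ∧ a * (1 - 1 / 50) ≤ d ∧
        (d ≤ a * (1 + 1 / 50) ∨ a * (63 / 50) ≤ d) := by
    intro η hη hηr hη2
    obtain ⟨k, hmatch, hgk⟩ :=
      (((LocalConfig.tendsto_iff_locallyMatches.1 hY) (max ‖y‖ ‖w‖) η hη).and hgood).exists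
    obtain ⟨p, hp, hyp⟩ := hmatch.2 y hy (le_max_left _ _)
    obtain ⟨q, hq, hwq⟩ := hmatch.2 w hw (le_max_right _ _)
    have hpq : p ≠ q := by
      intro h
      rw [h] at hyp
      have : dist y w ≤ dist y q + dist w q := dist_triangle_right _ _ _
      linarith
    have hpnorm : ‖p‖ ≤ r := by
      have h1 := norm_sub_norm_le p y
      rw [← dist_eq_norm, dist_comm] at h1
      linarith
    obtain ⟨-, hradS⟩ := hgk p hp hpnorm
    obtain ⟨hlo, hdisj⟩ := hradS q hq (Ne.symm hpq)
    refine ⟨dist p q, ?_, hlo, hdisj⟩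
    rw [abs_sub_le_iff]
    constructor
    · have : dist p q ≤ dist p y + (dist y w + dist w q) :=
        (dist_triangle p y q).trans (by gcongr; exact dist_triangle _ _ _)
      rw [dist_comm p y] at this
      linarith
    · have : dist y w ≤ dist y p + (dist p q + dist q w) :=
        (dist_triangle y p w).trans (by gcongr; exact dist_triangle _ _ _)
      rw [dist_comm q w] at this
      linarith
  have hlow : a * (1 - 1 / 50) ≤ dist y w := by
    refine le_of_forall_pos_lt_add fun ε hε => ?_
    have hm0 : 0 < min (r - ‖y‖) (min (dist y w / 4) (ε / 4)) :=
      lt_min hr (lt_min (by linarith) (by linarith))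
    have hm1 : min (r - ‖y‖) (min (dist y w / 4) (ε / 4)) ≤ dist y w / 4 :=
      (min_le_right _ _).trans (min_le_left _ _)
    have hm2 : min (r - ‖y‖) (min (dist y w / 4) (ε / 4)) ≤ ε / 4 :=
      (min_le_right _ _).trans (min_le_right _ _)
    obtain ⟨d, hd, hlo, -⟩ := key _ hm0 (min_le_left _ _) (by linarith)
    have h1 := (abs_sub_le_iff.1 hd).1
    linarith
  refine ⟨hlow, ?_⟩
  by_cases hcase : dist y w ≤ a * (1 + 1 / 50)
  · exact Or.inl hcase
  · right
    push Not at hcase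
    refine le_of_forall_pos_lt_add fun ε hε => ?_
    have hgap0 : 0 < dist y w - a * (1 + 1 / 50) := by linarith
    have hm0 : 0 < min (r - ‖y‖) (min (dist y w / 4) (min (ε / 4) ((dist y w - a * (1 + 1 / 50)) / 4))) :=
      lt_min hr (lt_min (by linarith) (lt_min (by linarith) (by linarith)))
    have hm1 : min (r - ‖y‖) (min (dist y w / 4) (min (ε / 4) ((dist y w - a * (1 + 1 / 50)) / 4))) ≤
        dist y w / 4 := (min_le_right _ _).trans (min_le_left _ _)
    have hm2 : min (r - ‖y‖) (min (dist y w / 4) (min (ε / 4) ((dist y w - a * (1 + 1 / 50)) / 4))) ≤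
        ε / 4 := ((min_le_right _ _).trans (min_le_right _ _)).trans (min_le_left _ _)
    have hm3 : min (r - ‖y‖) (min (dist y w / 4) (min (ε / 4) ((dist y w - a * (1 + 1 / 50)) / 4))) ≤
        (dist y w - a * (1 + 1 / 50)) / 4 :=
      ((min_le_right _ _).trans (min_le_right _ _)).trans (min_le_right _ _)
    obtain ⟨d, hd, -, hdisj⟩ := key _ hm0 (min_le_left _ _) (by linarith)
    obtain ⟨h1, h2⟩ := abs_sub_le_iff.1 hd
    rcases hdisj with h | h
    · exfalso
      linarith
    · linarith

/-- GAPPED-TWELVE IS CLOSED under local-rubber limits of `δ`-separated configurations (sitewise,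
with radius loss): `radial_of_tendsto` + `gappedTwelve_transfer` applied to a fine matching
(`tendsto_iff_locallyMatches`). This is hypothesis `hclG` of the schema for `Good := GappedTwelve a`.
PROVED. -/
theorem gappedTwelve_of_tendsto {S : ℕ → LocalConfig E3} {Y : LocalConfig E3} {a δ : ℝ}
    (ha : 0 < a) (hδ : 0 < δ) (hS : ∀ k, ∀ u ∈ S k, ∀ v ∈ S k, u ≠ v → δ ≤ dist u v)
    (hY : Tendsto S atTop (𝓝 Y)) {y : E3} {r : ℝ} (hy : y ∈ Y) (hyr : ‖y‖ < r)
    (hgood : ∀ᶠ k in atTop, ∀ p ∈ S k, ‖p‖ ≤ r → GappedTwelve a (S k : Set E3) p) :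
    GappedTwelve a (Y : Set E3) y := by
  have hrad := radial_of_tendsto ha hδ hS hY hy hyr hgood
  have hr : 0 < r - ‖y‖ := by linarith
  -- the limit is `δ`-separated (closed class)
  have hYsep : ∀ u ∈ Y, ∀ v ∈ Y, u ≠ v → δ ≤ dist u v :=
    (LocalConfig.isClosed_setOf_separated δ).mem_of_tendsto hY (Eventually.of_forall hS)
  -- a fine matching scale
  set η : ℝ := min (δ / 4) (min (a / 50) (min ((r - ‖y‖) / 2) 1)) with hη_def
  have hη : 0 < η := lt_min (by positivity) (lt_min (by positivity) (lt_min (by positivity) one_pos))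
  have hηδ : η ≤ δ / 4 := min_le_left _ _
  have hηa : η ≤ a / 50 := (min_le_right _ _).trans (min_le_left _ _)
  have hηr : η ≤ (r - ‖y‖) / 2 := ((min_le_right _ _).trans (min_le_right _ _)).trans (min_le_left _ _)
  have hη1 : η ≤ 1 := ((min_le_right _ _).trans (min_le_right _ _)).trans (min_le_right _ _)
  obtain ⟨k, hmatch, hgk⟩ :=
    (((LocalConfig.tendsto_iff_locallyMatches.1 hY) (‖y‖ + 1 + 2 * a) η hη).and hgood).exists
  obtain ⟨p, hp, hyp⟩ := hmatch.2 y hy (by linarith)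
  have hpn : ‖p‖ ≤ ‖y‖ + η := by
    have h1 := norm_sub_norm_le p y
    rw [← dist_eq_norm, dist_comm] at h1
    linarith
  have hg : GappedTwelve a (S k : Set E3) p := hgk p hp (by linarith)
  exact gappedTwelve_transfer ha hδ hη.le (by linarith) (by linarith) (hS k) hYsep hmatch.symm hp hy
    (by rw [dist_comm]; exact hyp) (by linarith) hg hrad

/-- Finite-dimensional compactness step, pattern fixed: if injective labellings `g : P → T` with
isometries `A_n` at tolerance `1/5 + ε n` occur frequently and `ε n → 0`, then
`ShellCloseTo (1/5) T P` — pigeonhole on the finitely many `g`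
(`exists_frequently_eq_of_forall_mem`), sequential compactness of O(3)
(`exists_subseq_tendsto_linearIsometry`), closedness of `≤`; the pattern of the landed
`PalmGoodLaw.exists_bijOn_of_frequently`, with `EtaMatched`'s `Equiv` assembled at the end. PROVED. -/
theorem shellCloseTo_of_frequently {T P : Finset E3} (hcard : T.card = P.card) {ε : ℕ → ℝ}
    (hε : Tendsto ε atTop (𝓝 0))
    (h : ∃ᶠ n in atTop, ∃ (g : ↥P → ↥T) (A : E3 →ₗᵢ[ℝ] E3),
      Function.Injective g ∧ ∀ v : ↥P, dist ((g v : ↥T) : E3) (A v) ≤ 1 / 5 + ε n) :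
    ShellCloseTo (1 / 5) T P := by
  classical
  obtain ⟨ψ₀, hψ₀, hall⟩ := extraction_of_frequently_atTop h
  choose g A hginj hdist using hall
  obtain ⟨g₀, -, hfreq⟩ :=
    Summit.AtomisticToContinuum.Crystallization.Theorems.exists_frequently_eq_of_forall_mem
      (F := Finset.univ) (y := g) fun k => Finset.mem_univ _
  obtain ⟨ψ₁, hψ₁, hg₀⟩ := extraction_of_frequently_atTop hfreq
  obtain ⟨ψ₂, hψ₂, B, hB⟩ :=
    Summit.AtomisticToContinuum.Crystallization.Theorems.exists_subseq_tendsto_linearIsometry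
      fun k => A (ψ₁ k)
  have hg₀inj : Function.Injective g₀ := by
    rw [← hg₀ 0]
    exact hginj _
  have hg₀bij : Function.Bijective g₀ := by
    rw [Fintype.bijective_iff_injective_and_card]
    refine ⟨hg₀inj, ?_⟩
    simp only [Fintype.card_coe]
    exact hcard.symm
  -- the displacement bound passes to the limit isometry
  have hlim : ∀ v : ↥P, dist ((g₀ v : ↥T) : E3) (B v) ≤ 1 / 5 := by
    intro v
    have hA : Tendsto (fun k => A (ψ₁ (ψ₂ k)) v) atTop (𝓝 (B v)) := by
      have h1 : Tendsto (fun k => (A (ψ₁ (ψ₂ k))).toContinuousLinearMap) atTop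
          (𝓝 B.toContinuousLinearMap) := hB
      exact ((ContinuousLinearMap.apply ℝ E3 (v : E3)).continuous.tendsto _).comp h1
    have hL : Tendsto (fun k => dist ((g₀ v : ↥T) : E3) (A (ψ₁ (ψ₂ k)) v)) atTop
        (𝓝 (dist ((g₀ v : ↥T) : E3) (B v))) := tendsto_const_nhds.dist hA
    have hR : Tendsto (fun k => 1 / 5 + ε (ψ₀ (ψ₁ (ψ₂ k)))) atTop (𝓝 (1 / 5 + 0)) :=
      tendsto_const_nhds.add (hε.comp ((hψ₀.comp (hψ₁.comp hψ₂)).tendsto_atTop))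
    rw [add_zero] at hR
    refine le_of_tendsto_of_tendsto' hL hR fun k => ?_
    have := hdist (ψ₁ (ψ₂ k)) v
    rw [hg₀ (ψ₂ k)] at this
    exact this
  -- assemble the matching `T ≃ P.image B`
  set eP : ↥P ≃ ↥T := Equiv.ofBijective g₀ hg₀bij with heP
  have hBmem : ∀ v : ↥P, B v ∈ P.image B := fun v => Finset.mem_image_of_mem _ v.2
  set fB : ↥P → ↥(P.image B) := fun v => ⟨B v, hBmem v⟩ with hfB
  have hfBbij : Function.Bijective fB := by
    constructor
    · intro v v' hvv'
      have : (B v : E3) = B v' := congrArg Subtype.val hvv'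
      exact Subtype.ext (B.injective this)
    · rintro ⟨q, hq⟩
      obtain ⟨v, hv, rfl⟩ := Finset.mem_image.1 hq
      exact ⟨⟨v, hv⟩, rfl⟩
  set eB : ↥P ≃ ↥(P.image B) := Equiv.ofBijective fB hfBbij with heB
  refine ⟨B, eP.symm.trans eB, fun t => ?_⟩
  have hgt : g₀ (eP.symm t) = t := eP.apply_symm_apply t
  have h1 := hlim (eP.symm t)
  rw [hgt] at h1
  exact h1

/-- STAGE LABELLING (finite, one matching): from a clean stage site `p` near the limit site `y`,
an injective labelling of the LIMIT shell (rescaled, as the Finset `T`) by the stage's pattern `P`,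
at tolerance `1/5 + 2η/a`: pattern point `v` ↦ stage shell point (via the stage's `EtaMatched`
equivalence) ↦ its partner in `Y` (fine matching; it lies in the shell of `y` by the collar
argument) ↦ rescaled about `y`. PROVED. -/
theorem stage_labelling {S Y : Set E3} {a δ η R : ℝ} (ha : 0 < a) (hδ : 0 < δ) (hη : 0 ≤ η)
    (h2η : 2 * η < δ) (hηa : 25 * η < a) (hη1 : η ≤ 1)
    (hS : ∀ u ∈ S, ∀ v ∈ S, u ≠ v → δ ≤ dist u v)
    (hm : LocallyMatches R η Y S) {p y : E3} (hp : p ∈ S) (hyp : dist y p ≤ η)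
    (hR : ‖y‖ + 1 + 2 * a ≤ R) (hg : GappedTwelve a S p)
    (hrad : ∀ w ∈ Y, w ≠ y → a * (1 - 1 / 50) ≤ dist y w ∧
      (dist y w ≤ a * (1 + 1 / 50) ∨ a * (63 / 50) ≤ dist y w))
    {T Tk P : Finset E3}
    (hT : (↑T : Set E3) = (fun w => a⁻¹ • (w - y)) '' {w ∈ Y | w ≠ y ∧ dist y w ≤ a * (1 + 1 / 50)})
    (hTk : (↑Tk : Set E3) = (fun w => a⁻¹ • (w - p)) '' {w ∈ S | w ≠ p ∧ dist p w ≤ a * (1 + 1 / 50)})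
    (hclose : ShellCloseTo (1 / 5) Tk P) :
    ∃ (g : ↥P → ↥T) (A : E3 →ₗᵢ[ℝ] E3), Function.Injective g ∧
      ∀ v : ↥P, dist ((g v : ↥T) : E3) (A v) ≤ 1 / 5 + 2 * η / a := by
  classical
  obtain ⟨A, e, he⟩ := hclose
  have hAmem : ∀ v : ↥P, A v ∈ P.image A := fun v => Finset.mem_image_of_mem _ v.2
  -- the stage shell point labelled by `v`
  have H1 : ∀ v : ↥P, ∃ wk : E3, (wk ∈ S ∧ wk ≠ p ∧ dist p wk ≤ a * (1 + 1 / 50)) ∧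
      a⁻¹ • (wk - p) = ((e.symm ⟨A v, hAmem v⟩ : ↥Tk) : E3) := by
    intro v
    have hmem : ((e.symm ⟨A v, hAmem v⟩ : ↥Tk) : E3) ∈ (↑Tk : Set E3) :=
      (e.symm ⟨A v, hAmem v⟩).2
    rw [hTk] at hmem
    obtain ⟨wk, hwk, hwk_eq⟩ := hmem
    exact ⟨wk, hwk, hwk_eq⟩
  choose wk hwk hwk_eq using H1
  have hlowk : ∀ v, a * (1 - 1 / 50) ≤ dist p (wk v) := fun v =>
    (hg.2 (wk v) (hwk v).1 (hwk v).2.1).1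
  -- its partner in `Y`
  have H2 : ∀ v : ↥P, ∃ w ∈ Y, dist w (wk v) ≤ η := by
    intro v
    refine hm.1 (wk v) (hwk v).1 ?_
    have h1 := norm_sub_norm_le (wk v) p
    rw [← dist_eq_norm, dist_comm] at h1
    have h2 := norm_sub_norm_le p y
    rw [← dist_eq_norm, dist_comm] at h2
    nlinarith [(hwk v).2.2, ha]
  choose w hwY hw_dist using H2
  -- the partner lies in the shell of `y` (collar argument)
  have hw_ne : ∀ v, w v ≠ y := by
    intro v h
    have h1 : dist y (wk v) ≤ η := by rw [← h]; exact hw_dist v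
    have h2 : dist p (wk v) ≤ dist p y + dist y (wk v) := dist_triangle _ _ _
    rw [dist_comm p y] at h2
    nlinarith [hlowk v, ha]
  have hw_sh : ∀ v, dist y (w v) ≤ a * (1 + 1 / 50) := by
    intro v
    have hup : dist y (w v) ≤ a * (1 + 1 / 50) + 2 * η :=
      calc dist y (w v) ≤ dist y p + dist p (w v) := dist_triangle _ _ _
        _ ≤ dist y p + (dist p (wk v) + dist (wk v) (w v)) := by gcongr; exact dist_triangle _ _ _
        _ ≤ η + (a * (1 + 1 / 50) + η) := by
            gcongr
            · exact (hwk v).2.2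
            · rw [dist_comm]; exact hw_dist v
        _ = a * (1 + 1 / 50) + 2 * η := by ring
    rcases (hrad (w v) (hwY v) (hw_ne v)).2 with h | h
    · exact h
    · exfalso; nlinarith [ha]
  -- the labelling
  have hgmem : ∀ v : ↥P, a⁻¹ • (w v - y) ∈ T := by
    intro v
    rw [← Finset.mem_coe, hT]
    exact ⟨w v, ⟨hwY v, hw_ne v, hw_sh v⟩, rfl⟩
  refine ⟨fun v => ⟨a⁻¹ • (w v - y), hgmem v⟩, A, ?_, ?_⟩
  · intro v v' hvv'
    have h1 : a⁻¹ • (w v - y) = a⁻¹ • (w v' - y) := congrArg Subtype.val hvv'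
    have h2 : w v = w v' :=
      sub_left_injective (smul_right_injective E3 (inv_ne_zero ha.ne') h1)
    have h3 : wk v = wk v' := by
      by_contra hne
      have hsep := hS _ (hwk v).1 _ (hwk v').1 hne
      have : dist (wk v) (wk v') ≤ 2 * η :=
        calc dist (wk v) (wk v') ≤ dist (w v) (wk v) + dist (w v) (wk v') := dist_triangle_left _ _ _
          _ ≤ η + η := by
              gcongr
              · exact hw_dist v
              · rw [h2]; exact hw_dist v'
          _ = 2 * η := by ring
      linarith
    have h4 : (e.symm ⟨A v, hAmem v⟩ : ↥Tk) = e.symm ⟨A v', hAmem v'⟩ := by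
      apply Subtype.ext
      rw [← hwk_eq v, ← hwk_eq v', h3]
    have h5 := e.symm.injective h4
    have h6 : A v = A v' := congrArg Subtype.val h5
    exact Subtype.ext (A.injective h6)
  · intro v
    show dist (a⁻¹ • (w v - y)) (A v) ≤ 1 / 5 + 2 * η / a
    have hd1 : dist (a⁻¹ • (w v - y)) (a⁻¹ • (wk v - p)) ≤ 2 * η / a := by
      rw [dist_smul₀, norm_inv, Real.norm_of_nonneg ha.le, dist_eq_norm]
      have hnum : ‖(w v - y) - (wk v - p)‖ ≤ 2 * η := by
        have hrew : (w v - y) - (wk v - p) = (w v - wk v) + (p - y) := by abel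
        rw [hrew]
        have ha1 : ‖w v - wk v‖ ≤ η := by rw [← dist_eq_norm]; exact hw_dist v
        have ha2 : ‖p - y‖ ≤ η := by rw [← dist_eq_norm, dist_comm]; exact hyp
        calc ‖(w v - wk v) + (p - y)‖ ≤ ‖w v - wk v‖ + ‖p - y‖ := norm_add_le _ _
          _ ≤ η + η := add_le_add ha1 ha2
          _ = 2 * η := by ring
      calc a⁻¹ * ‖(w v - y) - (wk v - p)‖ ≤ a⁻¹ * (2 * η) := by gcongr
        _ = 2 * η / a := by ring
    have hd2 : dist (a⁻¹ • (wk v - p)) (A v) ≤ 1 / 5 := by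
      rw [hwk_eq v]
      have := he (e.symm ⟨A v, hAmem v⟩)
      rwa [Equiv.apply_symm_apply] at this
    calc dist (a⁻¹ • (w v - y)) (A v)
        ≤ dist (a⁻¹ • (w v - y)) (a⁻¹ • (wk v - p)) + dist (a⁻¹ • (wk v - p)) (A v) :=
          dist_triangle _ _ _
      _ ≤ 2 * η / a + 1 / 5 := add_le_add hd1 hd2
      _ = 1 / 5 + 2 * η / a := by ring

/-- CLEAN (typed) SITES ARE CLOSED: the twelve shell points converge (collar transfer gives the
bijections), one of the finitely many labellings `pattern → shell` recurs (pigeonhole,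
`exists_frequently_eq_of_forall_mem`), the isometries converge along a subsequence
(`exists_subseq_tendsto_linearIsometry`, tree), and `≤ 1/5` passes to the limit. Hypothesis `hclC`
of the schema for `Clean := CleanSite a`. PROVED. -/
theorem cleanSite_of_tendsto {S : ℕ → LocalConfig E3} {Y : LocalConfig E3} {a δ : ℝ}
    (ha : 0 < a) (hδ : 0 < δ) (hS : ∀ k, ∀ u ∈ S k, ∀ v ∈ S k, u ≠ v → δ ≤ dist u v)
    (hY : Tendsto S atTop (𝓝 Y)) {y : E3} {r : ℝ} (hy : y ∈ Y) (hyr : ‖y‖ < r)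
    (hgood : ∀ᶠ k in atTop, ∀ p ∈ S k, ‖p‖ ≤ r → CleanSite a (S k : Set E3) p) :
    CleanSite a (Y : Set E3) y := by
  classical
  have hgoodG : ∀ᶠ k in atTop, ∀ p ∈ S k, ‖p‖ ≤ r → GappedTwelve a (S k : Set E3) p :=
    hgood.mono fun k hk p hp hpr => (hk p hp hpr).1
  have hGY : GappedTwelve a (Y : Set E3) y := gappedTwelve_of_tendsto ha hδ hS hY hy hyr hgoodG
  have hrad := radial_of_tendsto ha hδ hS hY hy hyr hgoodG
  refine ⟨hGY, ?_⟩
  -- the limit shell as a `Finset` of twelve points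
  have hfin : {w ∈ (Y : Set E3) | w ≠ y ∧ dist y w ≤ a * (1 + 1 / 50)}.Finite :=
    Set.finite_of_ncard_ne_zero (by rw [hGY.1]; norm_num)
  have hfinT := hfin.image (fun w => a⁻¹ • (w - y))
  have hresc_inj : Function.Injective fun w : E3 => a⁻¹ • (w - y) := fun u v huv =>
    sub_left_injective (smul_right_injective E3 (inv_ne_zero ha.ne') huv)
  have hT : (↑hfinT.toFinset : Set E3) =
      (fun w => a⁻¹ • (w - y)) '' {w ∈ (Y : Set E3) | w ≠ y ∧ dist y w ≤ a * (1 + 1 / 50)} :=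
    hfinT.coe_toFinset
  have hTcard : hfinT.toFinset.card = 12 := by
    rw [← Set.ncard_coe_finset, hT, Set.ncard_image_of_injective _ hresc_inj, hGY.1]
  refine ⟨hfinT.toFinset, hT, ?_⟩
  -- matching scales `ηs n → 0`
  have hr : 0 < r - ‖y‖ := by linarith
  set η₀ : ℝ := min (δ / 4) (min (a / 50) (min ((r - ‖y‖) / 2) 1)) with hη₀_def
  have hη₀ : 0 < η₀ := lt_min (by positivity) (lt_min (by positivity) (lt_min (by positivity) one_pos))
  have hη₀δ : η₀ ≤ δ / 4 := min_le_left _ _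
  have hη₀a : η₀ ≤ a / 50 := (min_le_right _ _).trans (min_le_left _ _)
  have hη₀r : η₀ ≤ (r - ‖y‖) / 2 := ((min_le_right _ _).trans (min_le_right _ _)).trans (min_le_left _ _)
  have hη₀1 : η₀ ≤ 1 := ((min_le_right _ _).trans (min_le_right _ _)).trans (min_le_right _ _)
  set ηs : ℕ → ℝ := fun n => η₀ * (1 / ((n : ℝ) + 1)) with hηs_def
  have hηs_pos : ∀ n, 0 < ηs n := fun n => by positivity
  have hηs_le : ∀ n, ηs n ≤ η₀ := fun n => by
    have h1 : 1 / ((n : ℝ) + 1) ≤ 1 := by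
      rw [div_le_one (by positivity)]
      linarith [(Nat.cast_nonneg n : (0 : ℝ) ≤ n)]
    calc ηs n = η₀ * (1 / ((n : ℝ) + 1)) := rfl
      _ ≤ η₀ * 1 := by gcongr
      _ = η₀ := mul_one _
  have hεlim : Tendsto (fun n => 2 * ηs n / a) atTop (𝓝 0) := by
    have h := (tendsto_one_div_add_atTop_nhds_zero_nat).const_mul (2 * η₀ / a)
    rw [mul_zero] at h
    refine h.congr fun n => ?_
    simp only [hηs_def]
    ring
  -- stage data at every `n`: an injective labelling of the limit shell by a pattern, for fcc or hcp
  have hstage : ∀ n : ℕ,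
      (∃ (g : ↥fccKissingPattern → ↥hfinT.toFinset) (A : E3 →ₗᵢ[ℝ] E3), Function.Injective g ∧
        ∀ v, dist ((g v : ↥hfinT.toFinset) : E3) (A v) ≤ 1 / 5 + 2 * ηs n / a) ∨
      (∃ (g : ↥hcpKissingPattern → ↥hfinT.toFinset) (A : E3 →ₗᵢ[ℝ] E3), Function.Injective g ∧
        ∀ v, dist ((g v : ↥hfinT.toFinset) : E3) (A v) ≤ 1 / 5 + 2 * ηs n / a) := by
    intro n
    obtain ⟨k, hmatch, hgk⟩ :=
      (((LocalConfig.tendsto_iff_locallyMatches.1 hY) (‖y‖ + 1 + 2 * a) (ηs n) (hηs_pos n)).and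
        hgood).exists
    obtain ⟨p, hp, hyp⟩ := hmatch.2 y hy (by linarith)
    have hpn : ‖p‖ ≤ ‖y‖ + ηs n := by
      have h1 := norm_sub_norm_le p y
      rw [← dist_eq_norm, dist_comm] at h1
      linarith
    have hclean : CleanSite a (S k : Set E3) p := hgk p hp (by linarith [hηs_le n])
    obtain ⟨hgp, Tk, hTk, hclose⟩ := hclean
    have h2η : 2 * ηs n < δ := by linarith [hηs_le n]
    have h25 : 25 * ηs n < a := by linarith [hηs_le n]
    rcases hclose with hf | hh
    · exact Or.inl (stage_labelling ha hδ (hηs_pos n).le h2η h25 ((hηs_le n).trans hη₀1) (hS k)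
        hmatch hp hyp le_rfl hgp hrad hT hTk hf)
    · exact Or.inr (stage_labelling ha hδ (hηs_pos n).le h2η h25 ((hηs_le n).trans hη₀1) (hS k)
        hmatch hp hyp le_rfl hgp hrad hT hTk hh)
  -- one of the two patterns occurs frequently
  have hfreq : (∃ᶠ n in atTop, ∃ (g : ↥fccKissingPattern → ↥hfinT.toFinset) (A : E3 →ₗᵢ[ℝ] E3),
        Function.Injective g ∧ ∀ v, dist ((g v : ↥hfinT.toFinset) : E3) (A v) ≤ 1 / 5 + 2 * ηs n / a) ∨
      (∃ᶠ n in atTop, ∃ (g : ↥hcpKissingPattern → ↥hfinT.toFinset) (A : E3 →ₗᵢ[ℝ] E3),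
        Function.Injective g ∧ ∀ v, dist ((g v : ↥hfinT.toFinset) : E3) (A v) ≤ 1 / 5 + 2 * ηs n / a) := by
    by_contra hcon
    obtain ⟨h1, h2⟩ := not_or.1 hcon
    rw [not_frequently] at h1 h2
    obtain ⟨n, hn1, hn2⟩ := (h1.and h2).exists
    rcases hstage n with h | h
    · exact hn1 h
    · exact hn2 h
  rcases hfreq with h | h
  · exact Or.inl (shellCloseTo_of_frequently (by rw [hTcard, card_fccKissingPattern]) hεlim h)
  · exact Or.inr (shellCloseTo_of_frequently (by rw [hTcard, card_hcpKissingPattern]) hεlim h)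

/-! ## Consistency check: the schema instance has the crux's conclusion shape -/

/-- `CleanSite a Y y` is, definitionally, the per-site conjunct of `CleanLocalLimit`. -/
example (a : ℝ) (Y : Set E3) (y : E3) :
    CleanSite a Y y ↔
      (({w ∈ Y | w ≠ y ∧ dist y w ≤ a * (1 + 1 / 50)}.ncard = 12 ∧
        ∀ w ∈ Y, w ≠ y → a * (1 - 1 / 50) ≤ dist y w ∧
          (dist y w ≤ a * (1 + 1 / 50) ∨ a * (63 / 50) ≤ dist y w)) ∧
      ∃ T : Finset E3, (↑T : Set E3) = (fun w => a⁻¹ • (w - y)) '' {w ∈ Y | w ≠ y ∧ dist y w ≤ a * (1 + 1 / 50)} ∧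
        (ShellCloseTo (1 / 5) T fccKissingPattern ∨ ShellCloseTo (1 / 5) T hcpKissingPattern)) :=
  Iff.rfl

/-! ## Instance lemmas (prover-side bonus): covariance, index ↔ point, counting -/

/-- The bond shell of a re-rooted configuration is the re-rooted bond shell. -/
theorem shell_translate (a : ℝ) (Y : Set E3) (y v : E3) :
    {w ∈ (fun w => w - v) '' Y | w ≠ y - v ∧ dist (y - v) w ≤ a * (1 + 1 / 50)} =
      (fun w => w - v) '' {w ∈ Y | w ≠ y ∧ dist y w ≤ a * (1 + 1 / 50)} := by
  ext w'
  constructor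
  · rintro ⟨⟨w, hw, rfl⟩, hne, hd⟩
    exact ⟨w, ⟨hw, fun h => hne (by rw [h]), by rwa [dist_sub_right] at hd⟩, rfl⟩
  · rintro ⟨w, ⟨hw, hne, hd⟩, rfl⟩
    exact ⟨⟨w, hw, rfl⟩, fun h => hne (sub_left_injective h), by rwa [dist_sub_right]⟩

/-- Re-rooting covariance of gapped-twelve (hypothesis `hcovG` of the schema). PROVED. -/
theorem gappedTwelve_translate_iff (a : ℝ) (Y : Set E3) (y v : E3) :
    GappedTwelve a ((fun w => w - v) '' Y) (y - v) ↔ GappedTwelve a Y y := by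
  unfold GappedTwelve
  rw [shell_translate, Set.ncard_image_of_injective _ sub_left_injective]
  refine and_congr Iff.rfl ⟨fun h w hw hne => ?_, fun h => ?_⟩
  · have := h (w - v) ⟨w, hw, rfl⟩ (fun h' => hne (sub_left_injective h'))
    rwa [dist_sub_right] at this
  · rintro _ ⟨w, hw, rfl⟩ hne
    rw [dist_sub_right]
    exact h w hw (fun h' => hne (by rw [h']))

/-- Re-rooting covariance of the typing clause (hypothesis `hcovC`). PROVED. -/
theorem fccHcpShell_translate_iff (a : ℝ) (Y : Set E3) (y v : E3) :
    FccHcpShell a ((fun w => w - v) '' Y) (y - v) ↔ FccHcpShell a Y y := by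
  have hset : (fun w => a⁻¹ • (w - (y - v))) ''
      {w ∈ (fun w => w - v) '' Y | w ≠ y - v ∧ dist (y - v) w ≤ a * (1 + 1 / 50)} =
      (fun w => a⁻¹ • (w - y)) '' {w ∈ Y | w ≠ y ∧ dist y w ≤ a * (1 + 1 / 50)} := by
    rw [shell_translate, Set.image_image]
    congr 1
    funext w
    rw [sub_sub_sub_cancel_right]
  unfold FccHcpShell
  rw [hset]

/-- Re-rooting covariance of clean sites. PROVED. -/
theorem cleanSite_translate_iff (a : ℝ) (Y : Set E3) (y v : E3) :
    CleanSite a ((fun w => w - v) '' Y) (y - v) ↔ CleanSite a Y y :=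
  and_congr (gappedTwelve_translate_iff a Y y v) (fccHcpShell_translate_iff a Y y v)

/-- Index form (the route's `RadialDefectsVanish` clause for particle `i`) ⇒ point form
(`GappedTwelve` on `range z`) for an injective configuration. PROVED. -/
theorem gappedTwelve_range_of_idx {N : ℕ} {z : Fin N → E3} (hz : Function.Injective z) {a : ℝ}
    {i : Fin N}
    (h : (Finset.univ.filter fun j : Fin N => j ≠ i ∧ dist (z i) (z j) ≤ a * (1 + 1 / 50)).card = 12 ∧
      ∀ j : Fin N, j ≠ i → a * (1 - 1 / 50) ≤ dist (z i) (z j) ∧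
        (dist (z i) (z j) ≤ a * (1 + 1 / 50) ∨ a * (63 / 50) ≤ dist (z i) (z j))) :
    GappedTwelve a (Set.range z) (z i) := by
  classical
  obtain ⟨hcard, hrad⟩ := h
  constructor
  · have hset : {w ∈ Set.range z | w ≠ z i ∧ dist (z i) w ≤ a * (1 + 1 / 50)} =
        z '' ↑(Finset.univ.filter fun j : Fin N => j ≠ i ∧ dist (z i) (z j) ≤ a * (1 + 1 / 50)) := by
      ext w
      constructor
      · rintro ⟨⟨j, rfl⟩, hne, hd⟩
        refine ⟨j, ?_, rfl⟩
        simp only [Finset.coe_filter, Finset.mem_univ, true_and, Set.mem_setOf_eq]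
        exact ⟨fun h => hne (by rw [h]), hd⟩
      · rintro ⟨j, hj, rfl⟩
        simp only [Finset.coe_filter, Finset.mem_univ, true_and, Set.mem_setOf_eq] at hj
        exact ⟨⟨j, rfl⟩, fun h => hj.1 (hz h), hj.2⟩
    rw [hset, Set.ncard_image_of_injective _ hz, Set.ncard_coe_finset, hcard]
  · rintro _ ⟨j, rfl⟩ hne
    exact hrad j (fun h => hne (by rw [h]))

/-- COUNTING STEP (ball counting with the hard core): if the bad particles number at most `θN`
frequently for every `θ > 0`, then for every radius `k`, frequently some particle has only good
particles within `k` (shadows of bad particles have at most `(2k/δ + 1)³` members). PROVED. -/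
theorem frequently_exists_good_ball {x : (N : ℕ) → (Fin N → E3)} {δ : ℝ} (hδ : 0 < δ)
    (hsep : ∀ N (i j : Fin N), i ≠ j → δ ≤ dist (x N i) (x N j))
    (good : (N : ℕ) → Fin N → Prop)
    (hRDV : ∀ θ : ℝ, 0 < θ → ∃ᶠ N in atTop, (Nat.card {i : Fin N // ¬ good N i} : ℝ) ≤ θ * N)
    (k : ℝ) (hk : 0 ≤ k) :
    ∃ᶠ N in atTop, ∃ i : Fin N, ∀ j : Fin N, dist (x N j) (x N i) ≤ k → good N j := by
  classical
  set C : ℝ := (2 * k / δ + 1) ^ 3 with hC_def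
  have hC : 0 < C := by positivity
  refine ((hRDV (1 / (2 * C)) (by positivity)).and_eventually (eventually_ge_atTop 1)).mono ?_
  rintro N ⟨hbad, hN1⟩
  by_contra hcon
  push Not at hcon
  choose f hf hfbad using hcon
  have hinj : Function.Injective (x N) := by
    intro i j hij
    by_contra hne
    have := hsep N i j hne
    rw [hij, dist_self] at this
    linarith
  set Bad : Finset (Fin N) := Finset.univ.filter fun j : Fin N => ¬ good N j with hBad_def
  have hBadcard : (Bad.card : ℝ) = Nat.card {i : Fin N // ¬ good N i} := by
    rw [Nat.card_eq_fintype_card, Fintype.card_subtype]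
  -- fibres of `f` are shadows of bad particles: at most `C` members each
  have hfib : ∀ j ∈ Bad, ((Finset.univ.filter fun i : Fin N => f i = j).card : ℝ) ≤ C := by
    intro j _
    have h := card_le_of_separated_of_dist_le
      ((Finset.univ.filter fun i : Fin N => f i = j).image (x N)) (x N j) hδ hk ?_ ?_
    · rw [Finset.card_image_of_injective _ hinj, finrank_euclideanSpace_fin] at h
      exact h
    · intro c hc
      obtain ⟨i, hi, rfl⟩ := Finset.mem_image.1 hc
      have hij : f i = j := (Finset.mem_filter.1 hi).2
      rw [← hij, dist_comm]
      exact hf i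
    · intro c hc d hd hcd
      obtain ⟨i, -, rfl⟩ := Finset.mem_image.1 hc
      obtain ⟨i', -, rfl⟩ := Finset.mem_image.1 hd
      exact hsep N i i' fun h => hcd (by rw [h])
  have hcover : (Finset.univ : Finset (Fin N)) ⊆
      Bad.biUnion fun j => Finset.univ.filter fun i : Fin N => f i = j := by
    intro i _
    rw [Finset.mem_biUnion]
    exact ⟨f i, Finset.mem_filter.2 ⟨Finset.mem_univ _, hfbad i⟩,
      Finset.mem_filter.2 ⟨Finset.mem_univ _, rfl⟩⟩
  have h1 : (N : ℝ) ≤ Bad.card * C := by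
    have h2 := Finset.card_le_card hcover
    rw [Finset.card_univ, Fintype.card_fin] at h2
    have h3 := Finset.card_biUnion_le (s := Bad)
      (t := fun j => Finset.univ.filter fun i : Fin N => f i = j)
    calc (N : ℝ) ≤ ((Bad.biUnion fun j => Finset.univ.filter fun i : Fin N => f i = j).card : ℝ) := by
          exact_mod_cast h2
      _ ≤ ((∑ j ∈ Bad, (Finset.univ.filter fun i : Fin N => f i = j).card : ℕ) : ℝ) := by
          exact_mod_cast h3
      _ = ∑ j ∈ Bad, ((Finset.univ.filter fun i : Fin N => f i = j).card : ℝ) := by push_cast; rfl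
      _ ≤ ∑ j ∈ Bad, C := Finset.sum_le_sum hfib
      _ = Bad.card * C := by rw [Finset.sum_const, nsmul_eq_mul]
  rw [← hBadcard] at hbad
  have hN : (1 : ℝ) ≤ N := by exact_mod_cast hN1
  have h4 : (Bad.card : ℝ) * C ≤ 1 / (2 * C) * N * C := by gcongr
  have h5 : 1 / (2 * C) * N * C = N / 2 := by field_simp
  linarith

/-! ## Card A, crux level: the rooted clean hull element, and the crux by name -/

/-- Card A, the crux through the hull: from the radial statement AT ONE SCALE `a` and the
alphabet-free rationing, a ROOTED, EVERYWHERE-CLEAN member of the hull (counting ⇒ rooted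
re-rootings clean on `B(0,k)`; `CompactSpace (LocalConfig E3)` ⇒ limit `Y₀ ∈ hull`, all
gapped-twelve by closedness; rationing ⇒ `Y₀.translate c_R ∈ hull` clean on `B(0,R)`; second
`tendsto_subseq`, limit in the CLOSED hull). PROVED. -/
theorem exists_clean_rooted_mem_hull (x : (N : ℕ) → (Fin N → E3))
    (hx : ∀ N, IsGroundState lennardJones (x N)) {a : ℝ} (ha : 0 < a)
    (hRDVa : ∀ θ : ℝ, 0 < θ → ∃ᶠ N in atTop,
      (Nat.card {i : Fin N // ¬ ((Finset.univ.filter fun j : Fin N =>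
          j ≠ i ∧ dist (x N i) (x N j) ≤ a * (1 + 1 / 50)).card = 12 ∧
        ∀ j : Fin N, j ≠ i → a * (1 - 1 / 50) ≤ dist (x N i) (x N j) ∧
          (dist (x N i) (x N j) ≤ a * (1 + 1 / 50) ∨ a * (63 / 50) ≤ dist (x N i) (x N j)))} : ℝ)
        ≤ θ * N)
    (hRat : GappedRationing) :
    ∃ Y ∈ hull x, (0 : E3) ∈ Y ∧ ∀ y ∈ Y, CleanSite a (Y : Set E3) y := by
  classical
  obtain ⟨δ, hδ, hsepGS⟩ := LennardJonesMinimalDistance_holds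
  have hsep : ∀ N (i j : Fin N), i ≠ j → δ ≤ dist (x N i) (x N j) :=
    fun N i j h => hsepGS N (x N) (hx N) i j h
  have hinj : ∀ N, Function.Injective (x N) := by
    intro N i j hij
    by_contra hne
    have := hsep N i j hne
    rw [hij, dist_self] at this
    linarith
  have hsepR : ∀ N, ∀ u ∈ Set.range (x N), ∀ v ∈ Set.range (x N), u ≠ v → δ ≤ dist u v := by
    rintro N _ ⟨i, rfl⟩ _ ⟨j, rfl⟩ hne
    exact hsep N i j fun h => hne (by rw [h])
  -- Step 1: good balls of every radius, along a strictly increasing subsequence of particle numbers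
  have hfreq := fun k : ℕ => frequently_exists_good_ball hδ hsep
    (fun N i => (Finset.univ.filter fun j : Fin N =>
        j ≠ i ∧ dist (x N i) (x N j) ≤ a * (1 + 1 / 50)).card = 12 ∧
      ∀ j : Fin N, j ≠ i → a * (1 - 1 / 50) ≤ dist (x N i) (x N j) ∧
        (dist (x N i) (x N j) ≤ a * (1 + 1 / 50) ∨ a * (63 / 50) ≤ dist (x N i) (x N j)))
    hRDVa k (Nat.cast_nonneg k)
  obtain ⟨Nk, hNk, hP⟩ := extraction_forall_of_frequently hfreq
  choose ik hik using hP
  -- Step 2: the rooted re-rootings `Z k`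
  set Z : ℕ → LocalConfig E3 := fun k => (cfg x (Nk k)).translate (x (Nk k) (ik k)) with hZ_def
  have hZroot : ∀ k, (0 : E3) ∈ Z k := fun k =>
    LocalConfig.zero_mem_translate (show x (Nk k) (ik k) ∈ cfg x (Nk k) from ⟨ik k, rfl⟩)
  have hZsep : ∀ k, ∀ u ∈ Z k, ∀ v ∈ Z k, u ≠ v → δ ≤ dist u v := fun k =>
    LocalConfig.separated_translate (S := cfg x (Nk k)) (hsepR (Nk k)) _
  have hZgood : ∀ k, ∀ p ∈ Z k, ‖p‖ ≤ k → GappedTwelve a (Z k : Set E3) p := by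
    intro k p hp hpk
    rw [LocalConfig.mem_translate_iff] at hp
    obtain ⟨j, hj⟩ := hp
    have hdist : dist (x (Nk k) j) (x (Nk k) (ik k)) ≤ k := by
      rw [hj, dist_eq_norm, add_sub_cancel_right]
      exact hpk
    have hg := gappedTwelve_range_of_idx (hinj _) (hik k j hdist)
    have hp' : p = x (Nk k) j - x (Nk k) (ik k) := by rw [hj, add_sub_cancel_right]
    rw [hp']
    change GappedTwelve a ((fun z => z - x (Nk k) (ik k)) '' Set.range (x (Nk k))) _
    exact (gappedTwelve_translate_iff a _ _ _).2 hg
  -- Step 3: first extraction; the limit is a rooted, separated, all-gapped-twelve hull element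
  obtain ⟨Y₀, ψ, hψ, hlim⟩ := CompactSpace.tendsto_subseq Z
  have hlim2 : Tendsto (fun k => (cfg x (Nk (ψ k))).translate (x (Nk (ψ k)) (ik (ψ k)))) atTop
      (𝓝 Y₀) := hlim
  have hY₀hull : Y₀ ∈ hull x :=
    mem_hull_of_tendsto (hNk.comp hψ) (fun k => x (Nk (ψ k)) (ik (ψ k))) hlim2
  have hY₀rs : (0 : E3) ∈ Y₀ ∧ ∀ u ∈ Y₀, ∀ v ∈ Y₀, u ≠ v → δ ≤ dist u v :=
    (LocalConfig.isClosed_setOf_rooted_separated hδ).mem_of_tendsto hlim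
      (Eventually.of_forall fun k => ⟨hZroot _, hZsep _⟩)
  have hY₀good : ∀ y ∈ Y₀, GappedTwelve a (Y₀ : Set E3) y := by
    intro y hy
    refine gappedTwelve_of_tendsto (S := Z ∘ ψ) ha hδ (fun k => hZsep (ψ k)) hlim hy
      (lt_add_one ‖y‖) ?_
    have hev : ∀ᶠ k in atTop, ‖y‖ + 1 ≤ ((ψ k : ℕ) : ℝ) :=
      (tendsto_natCast_atTop_atTop.comp hψ.tendsto_atTop).eventually (eventually_ge_atTop _)
    filter_upwards [hev] with k hk p hp hpr
    exact hZgood (ψ k) p hp (hpr.trans hk)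
  -- Step 4: rationing at every radius, re-rooting inside the hull, second extraction
  have hY₀ne : (Y₀ : Set E3).Nonempty := ⟨0, hY₀rs.1⟩
  have hcentre : ∀ m : ℕ, ∃ c ∈ (Y₀ : Set E3), ∀ y ∈ (Y₀ : Set E3), dist y c ≤ m →
      FccHcpShell a Y₀ y := fun m => hRat Y₀ a ha hY₀ne hY₀good m
  choose c hc hcm using hcentre
  set W : ℕ → LocalConfig E3 := fun m => Y₀.translate (c m) with hW_def
  have hWhull : ∀ m, W m ∈ hull x := fun m => translate_mem_hull hY₀hull _
  have hWroot : ∀ m, (0 : E3) ∈ W m := fun m => LocalConfig.zero_mem_translate (hc m)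
  have hWsep : ∀ m, ∀ u ∈ W m, ∀ v ∈ W m, u ≠ v → δ ≤ dist u v := fun m =>
    LocalConfig.separated_translate hY₀rs.2 _
  have hWclean : ∀ m, ∀ p ∈ W m, ‖p‖ ≤ m → CleanSite a (W m : Set E3) p := by
    intro m p hp hpm
    rw [LocalConfig.mem_translate_iff] at hp
    have hd : dist (p + c m) (c m) ≤ m := by
      rw [dist_eq_norm, add_sub_cancel_right]
      exact hpm
    have h1 : GappedTwelve a Y₀ (p + c m) := hY₀good _ hp
    have h2 : FccHcpShell a Y₀ (p + c m) := hcm m _ hp hd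
    have hp' : p = p + c m - c m := (add_sub_cancel_right _ _).symm
    rw [hp']
    change CleanSite a ((fun z => z - c m) '' (Y₀ : Set E3)) _
    exact (cleanSite_translate_iff a _ _ _).2 ⟨h1, h2⟩
  obtain ⟨Y, ψ', hψ', hlim'⟩ := CompactSpace.tendsto_subseq W
  have hYhull : Y ∈ hull x :=
    (isClosed_hull x).mem_of_tendsto hlim' (Eventually.of_forall fun m => hWhull _)
  have hYrs : (0 : E3) ∈ Y ∧ ∀ u ∈ Y, ∀ v ∈ Y, u ≠ v → δ ≤ dist u v :=
    (LocalConfig.isClosed_setOf_rooted_separated hδ).mem_of_tendsto hlim'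
      (Eventually.of_forall fun m => ⟨hWroot _, hWsep _⟩)
  refine ⟨Y, hYhull, hYrs.1, fun y hy => ?_⟩
  refine cleanSite_of_tendsto (S := W ∘ ψ') ha hδ (fun m => hWsep (ψ' m)) hlim' hy
    (lt_add_one ‖y‖) ?_
  have hev : ∀ᶠ m in atTop, ‖y‖ + 1 ≤ ((ψ' m : ℕ) : ℝ) :=
    (tendsto_natCast_atTop_atTop.comp hψ'.tendsto_atTop).eventually (eventually_ge_atTop _)
  filter_upwards [hev] with m hm p hp hpr
  exact hWclean (ψ' m) p hp (hpr.trans hm)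

/-- Card A assembled: the alphabet-free factor `RadialDefectsVanish → CleanLocalLimit` from the
rooted clean hull element and the dictionary. PROVED. -/
theorem cleanLimitExtraction_via_hull (hRat : GappedRationing) :
    RadialDefectsVanish → CleanLocalLimit := by
  intro hRDV x hx
  obtain ⟨a, ha1, ha2, hθ⟩ := hRDV x hx
  have ha : 0 < a := by linarith
  obtain ⟨Y, hY, h0, hclean⟩ := exists_clean_rooted_mem_hull x hx ha hθ hRat
  obtain ⟨φ, t, hφ, hT⟩ := exists_seq_of_mem_hull hY
  exact ⟨(Y : Set E3), a, ha1, ha2, h0, ⟨φ, fun n => -t n, hφ, cll_clause_of_tendsto hT⟩,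
    fun y hy => hclean y hy⟩

/-! ## Card B — predicate-generic extraction schema (limit-closed, translation-covariant sites), PROVED -/

/-- FIRST LEMMA of card B: the EXTRACTION SCHEMA. For site predicates `Clean ⊆ Good` on point sets
of `ℝ³` that are translation-covariant and SITEWISE CLOSED under local-rubber limits of
`δ`-separated configurations, a radial-defect statement for `Good` and a rationing statement
`Good everywhere ⇒ Clean balls of every radius` give a rooted local limit of re-rooted clusters of
THE GIVEN `x`, clean everywhere — the conclusion is literally the shape of `CleanLocalLimit`.
Instances: `Good := GappedTwelve a`, `Clean := CleanSite a` (card C supplies the two closedness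
hypotheses), and — after the expected `ShellCensus` repair — any `(τ, γ, η, alphabet)` variant.
PROVED (the hypothesis `hCG : Clean ⊆ Good` turned out to be unnecessary). -/
theorem clean_extraction_schema (Good Clean : Set E3 → E3 → Prop)
    (hCG : ∀ Y y, Clean Y y → Good Y y)
    (hcovG : ∀ (Y : Set E3) (y v : E3), Good ((fun w => w - v) '' Y) (y - v) ↔ Good Y y)
    (hcovC : ∀ (Y : Set E3) (y v : E3), Clean ((fun w => w - v) '' Y) (y - v) ↔ Clean Y y)
    {δ : ℝ} (hδ : 0 < δ)
    (hclG : ∀ (S : ℕ → LocalConfig E3) (Y : LocalConfig E3),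
      (∀ k, ∀ u ∈ S k, ∀ v ∈ S k, u ≠ v → δ ≤ dist u v) → Tendsto S atTop (𝓝 Y) →
      ∀ (y : E3) (r : ℝ), y ∈ Y → ‖y‖ < r →
        (∀ᶠ k in atTop, ∀ p ∈ S k, ‖p‖ ≤ r → Good (S k : Set E3) p) → Good (Y : Set E3) y)
    (hclC : ∀ (S : ℕ → LocalConfig E3) (Y : LocalConfig E3),
      (∀ k, ∀ u ∈ S k, ∀ v ∈ S k, u ≠ v → δ ≤ dist u v) → Tendsto S atTop (𝓝 Y) →
      ∀ (y : E3) (r : ℝ), y ∈ Y → ‖y‖ < r →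
        (∀ᶠ k in atTop, ∀ p ∈ S k, ‖p‖ ≤ r → Clean (S k : Set E3) p) → Clean (Y : Set E3) y)
    (x : (N : ℕ) → (Fin N → E3)) (hsep : ∀ N (i j : Fin N), i ≠ j → δ ≤ dist (x N i) (x N j))
    (hRDV : ∀ θ : ℝ, 0 < θ → ∃ᶠ N in atTop,
      (Nat.card {i : Fin N // ¬ Good (Set.range (x N)) (x N i)} : ℝ) ≤ θ * N)
    (hRat : ∀ Y : Set E3, Y.Nonempty → (∀ u ∈ Y, ∀ v ∈ Y, u ≠ v → δ ≤ dist u v) →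
      (∀ y ∈ Y, Good Y y) → ∀ R : ℝ, ∃ c ∈ Y, ∀ y ∈ Y, dist y c ≤ R → Clean Y y) :
    ∃ Y : Set E3, (0 : E3) ∈ Y ∧
      (∃ (φ : ℕ → ℕ) (t : ℕ → E3), StrictMono φ ∧ ∀ R ε : ℝ, 0 < ε → ∀ᶠ n in atTop,
        (∀ y ∈ Y, ‖y‖ ≤ R → ∃ i : Fin (φ n), dist (x (φ n) i + t n) y ≤ ε) ∧
        (∀ i : Fin (φ n), ‖x (φ n) i + t n‖ ≤ R → ∃ y ∈ Y, dist (x (φ n) i + t n) y ≤ ε)) ∧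
      ∀ y ∈ Y, Clean Y y := by
  classical
  have hinj : ∀ N, Function.Injective (x N) := by
    intro N i j hij
    by_contra hne
    have := hsep N i j hne
    rw [hij, dist_self] at this
    linarith
  have hsepR : ∀ N, ∀ u ∈ Set.range (x N), ∀ v ∈ Set.range (x N), u ≠ v → δ ≤ dist u v := by
    rintro N _ ⟨i, rfl⟩ _ ⟨j, rfl⟩ hne
    exact hsep N i j fun h => hne (by rw [h])
  -- Step 1: good balls of every radius along a strictly increasing subsequence
  have hfreq := fun k : ℕ => frequently_exists_good_ball hδ hsep
    (fun N i => Good (Set.range (x N)) (x N i)) hRDV k (Nat.cast_nonneg k)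
  obtain ⟨Nk, hNk, hP⟩ := extraction_forall_of_frequently hfreq
  choose ik hik using hP
  -- Step 2: rooted re-rootings
  set Z : ℕ → LocalConfig E3 := fun k => (cfg x (Nk k)).translate (x (Nk k) (ik k)) with hZ_def
  have hZroot : ∀ k, (0 : E3) ∈ Z k := fun k =>
    LocalConfig.zero_mem_translate (show x (Nk k) (ik k) ∈ cfg x (Nk k) from ⟨ik k, rfl⟩)
  have hZsep : ∀ k, ∀ u ∈ Z k, ∀ v ∈ Z k, u ≠ v → δ ≤ dist u v := fun k =>
    LocalConfig.separated_translate (S := cfg x (Nk k)) (hsepR (Nk k)) _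
  have hZgood : ∀ k, ∀ p ∈ Z k, ‖p‖ ≤ k → Good (Z k : Set E3) p := by
    intro k p hp hpk
    rw [LocalConfig.mem_translate_iff] at hp
    obtain ⟨j, hj⟩ := hp
    have hdist : dist (x (Nk k) j) (x (Nk k) (ik k)) ≤ k := by
      rw [hj, dist_eq_norm, add_sub_cancel_right]
      exact hpk
    have hg : Good (Set.range (x (Nk k))) (x (Nk k) j) := hik k j hdist
    have hp' : p = x (Nk k) j - x (Nk k) (ik k) := by rw [hj, add_sub_cancel_right]
    rw [hp']
    change Good ((fun z => z - x (Nk k) (ik k)) '' Set.range (x (Nk k))) _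
    exact (hcovG _ _ _).2 hg
  -- Step 3: first extraction
  obtain ⟨Y₀, ψ, hψ, hlim⟩ := CompactSpace.tendsto_subseq Z
  have hlim2 : Tendsto (fun k => (cfg x (Nk (ψ k))).translate (x (Nk (ψ k)) (ik (ψ k)))) atTop
      (𝓝 Y₀) := hlim
  have hY₀hull : Y₀ ∈ hull x :=
    mem_hull_of_tendsto (hNk.comp hψ) (fun k => x (Nk (ψ k)) (ik (ψ k))) hlim2
  have hY₀rs : (0 : E3) ∈ Y₀ ∧ ∀ u ∈ Y₀, ∀ v ∈ Y₀, u ≠ v → δ ≤ dist u v :=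
    (LocalConfig.isClosed_setOf_rooted_separated hδ).mem_of_tendsto hlim
      (Eventually.of_forall fun k => ⟨hZroot _, hZsep _⟩)
  have hY₀good : ∀ y ∈ Y₀, Good (Y₀ : Set E3) y := by
    intro y hy
    refine hclG (Z ∘ ψ) Y₀ (fun k => hZsep (ψ k)) hlim y (‖y‖ + 1) hy (lt_add_one _) ?_
    have hev : ∀ᶠ k in atTop, ‖y‖ + 1 ≤ ((ψ k : ℕ) : ℝ) :=
      (tendsto_natCast_atTop_atTop.comp hψ.tendsto_atTop).eventually (eventually_ge_atTop _)
    filter_upwards [hev] with k hk p hp hpr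
    exact hZgood (ψ k) p hp (hpr.trans hk)
  -- Step 4: rationing, re-rooting inside the hull, second extraction
  have hcentre : ∀ m : ℕ, ∃ c ∈ (Y₀ : Set E3), ∀ y ∈ (Y₀ : Set E3), dist y c ≤ m →
      Clean Y₀ y := fun m => hRat Y₀ ⟨0, hY₀rs.1⟩ hY₀rs.2 hY₀good m
  choose c hc hcm using hcentre
  set W : ℕ → LocalConfig E3 := fun m => Y₀.translate (c m) with hW_def
  have hWhull : ∀ m, W m ∈ hull x := fun m => translate_mem_hull hY₀hull _
  have hWroot : ∀ m, (0 : E3) ∈ W m := fun m => LocalConfig.zero_mem_translate (hc m)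
  have hWsep : ∀ m, ∀ u ∈ W m, ∀ v ∈ W m, u ≠ v → δ ≤ dist u v := fun m =>
    LocalConfig.separated_translate hY₀rs.2 _
  have hWclean : ∀ m, ∀ p ∈ W m, ‖p‖ ≤ m → Clean (W m : Set E3) p := by
    intro m p hp hpm
    rw [LocalConfig.mem_translate_iff] at hp
    have hd : dist (p + c m) (c m) ≤ m := by
      rw [dist_eq_norm, add_sub_cancel_right]
      exact hpm
    have h2 : Clean Y₀ (p + c m) := hcm m _ hp hd
    have hp' : p = p + c m - c m := (add_sub_cancel_right _ _).symm
    rw [hp']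
    change Clean ((fun z => z - c m) '' (Y₀ : Set E3)) _
    exact (hcovC _ _ _).2 h2
  obtain ⟨Y, ψ', hψ', hlim'⟩ := CompactSpace.tendsto_subseq W
  have hYhull : Y ∈ hull x :=
    (isClosed_hull x).mem_of_tendsto hlim' (Eventually.of_forall fun m => hWhull _)
  have hYrs : (0 : E3) ∈ Y ∧ ∀ u ∈ Y, ∀ v ∈ Y, u ≠ v → δ ≤ dist u v :=
    (LocalConfig.isClosed_setOf_rooted_separated hδ).mem_of_tendsto hlim'
      (Eventually.of_forall fun m => ⟨hWroot _, hWsep _⟩)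
  have hYclean : ∀ y ∈ Y, Clean (Y : Set E3) y := by
    intro y hy
    refine hclC (W ∘ ψ') Y (fun m => hWsep (ψ' m)) hlim' y (‖y‖ + 1) hy (lt_add_one _) ?_
    have hev : ∀ᶠ m in atTop, ‖y‖ + 1 ≤ ((ψ' m : ℕ) : ℝ) :=
      (tendsto_natCast_atTop_atTop.comp hψ'.tendsto_atTop).eventually (eventually_ge_atTop _)
    filter_upwards [hev] with m hm p hp hpr
    exact hWclean (ψ' m) p hp (hpr.trans hm)
  obtain ⟨φ, t, hφ, hT⟩ := exists_seq_of_mem_hull hYhull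
  exact ⟨(Y : Set E3), hYrs.1, ⟨φ, fun n => -t n, hφ, cll_clause_of_tendsto hT⟩, hYclean⟩


/-! ## Splice (this seat): the repaired antecedents give `GappedRationing`; the crux by name -/

/-- The common bonded neighbours of the bond `(y, v)`. -/
def CommonNbrs (a : ℝ) (Y : Set E3) (y v : E3) : Set E3 :=
  {w ∈ Y | w ≠ y ∧ w ≠ v ∧ dist y w ≤ a * (1 + 1 / 50) ∧ dist v w ≤ a * (1 + 1 / 50)}

/-- The rescaling `w ↦ a⁻¹ • (w - y)` is injective. -/
theorem rescale_injective {a : ℝ} (ha : 0 < a) (y : E3) :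
    Function.Injective fun w : E3 => a⁻¹ • (w - y) := fun u v huv => by
  have h := smul_right_injective E3 (inv_ne_zero ha.ne') huv
  exact sub_left_injective h

/-- Distances rescale: `dist (a⁻¹(v-y)) (a⁻¹(w-y)) = a⁻¹ dist v w`. -/
theorem dist_rescale {a : ℝ} (ha : 0 < a) (y v w : E3) :
    dist (a⁻¹ • (v - y)) (a⁻¹ • (w - y)) = a⁻¹ * dist v w := by
  rw [dist_smul₀, norm_inv, Real.norm_of_nonneg ha.le, dist_sub_right]

/-- THE RESCALED SHELL satisfies the three typing hypotheses of `ShellTrichotomy` at every site of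
an all-gapped-twelve configuration (twelve points; radii in `[0.98, 1.02]`; mutual distances
admissible because every shell point is itself a gapped-twelve site). PROVED. -/
theorem rescaledShell_hyps {Y : Set E3} {a : ℝ} (ha : 0 < a)
    (hgood : ∀ y ∈ Y, GappedTwelve a Y y) {y : E3} (hy : y ∈ Y) :
    ∃ T : Finset E3,
      (↑T : Set E3) = (fun w => a⁻¹ • (w - y)) '' {w ∈ Y | w ≠ y ∧ dist y w ≤ a * (1 + 1 / 50)} ∧
      T.card = 12 ∧ (∀ v ∈ T, 1 - 1 / 50 ≤ ‖v‖ ∧ ‖v‖ ≤ 1 + 1 / 50) ∧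
      (∀ v ∈ T, ∀ w ∈ T, v ≠ w → 1 - 1 / 50 ≤ dist v w ∧ (dist v w ≤ 1 + 1 / 50 ∨ 63 / 50 ≤ dist v w)) := by
  obtain ⟨hcount, hrad⟩ := hgood y hy
  have hfin : {w ∈ Y | w ≠ y ∧ dist y w ≤ a * (1 + 1 / 50)}.Finite :=
    Set.finite_of_ncard_ne_zero (by rw [hcount]; norm_num)
  have hfinT := hfin.image (fun w => a⁻¹ • (w - y))
  refine ⟨hfinT.toFinset, hfinT.coe_toFinset, ?_, ?_, ?_⟩
  · rw [← Set.ncard_coe_finset, hfinT.coe_toFinset, Set.ncard_image_of_injective _ (rescale_injective ha y),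
      hcount]
  · intro v hv
    rw [Set.Finite.mem_toFinset] at hv
    obtain ⟨w, ⟨hw, hwy, hd⟩, rfl⟩ := hv
    have hlo := (hrad w hw hwy).1
    rw [norm_smul, norm_inv, Real.norm_of_nonneg ha.le, ← dist_eq_norm, dist_comm]
    constructor
    · rw [le_inv_mul_iff₀ ha]; linarith
    · rw [inv_mul_le_iff₀ ha]; linarith
  · intro v hv v' hv' hvv'
    rw [Set.Finite.mem_toFinset] at hv hv'
    obtain ⟨w, ⟨hw, hwy, hd⟩, rfl⟩ := hv
    obtain ⟨w', ⟨hw', hw'y, hd'⟩, rfl⟩ := hv'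
    have hww' : w ≠ w' := fun h => hvv' (by rw [h])
    obtain ⟨h1, h2⟩ := (hgood w hw).2 w' hw' (Ne.symm hww')
    rw [dist_rescale ha]
    refine ⟨by rw [le_inv_mul_iff₀ ha]; linarith, ?_⟩
    rcases h2 with h | h
    · left; rw [inv_mul_le_iff₀ ha]; linarith
    · right; rw [le_inv_mul_iff₀ ha]; linarith

/-- THE DEGREE DICTIONARY (the crux's named bookkeeping step): for a bond `(y, v)`, the shell-degree
of `a⁻¹(v - y)` inside the rescaled shell `T` of `y` equals the number of common bonded neighbours
of `y` and `v`. PROVED. -/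
theorem shellDegree_eq_commonNbrs {Y : Set E3} {a : ℝ} (ha : 0 < a) {y : E3}
    {T : Finset E3}
    (hT : (↑T : Set E3) = (fun w => a⁻¹ • (w - y)) '' {w ∈ Y | w ≠ y ∧ dist y w ≤ a * (1 + 1 / 50)})
    {v : E3} (hv : v ∈ Y) (hvy : v ≠ y) (hdv : dist y v ≤ a * (1 + 1 / 50)) :
    (T.filter fun w' => w' ≠ a⁻¹ • (v - y) ∧ dist (a⁻¹ • (v - y)) w' ≤ 1 + 1 / 50).card =
      (CommonNbrs a Y y v).ncard := by
  classical
  have hfinj : Function.Injective (fun w : E3 => a⁻¹ • (w - y)) := rescale_injective ha y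
  -- the filtered Finset, as a set, is the image of the common-neighbour set
  have key : (↑(T.filter fun w' => w' ≠ a⁻¹ • (v - y) ∧ dist (a⁻¹ • (v - y)) w' ≤ 1 + 1 / 50) : Set E3) =
      (fun w : E3 => a⁻¹ • (w - y)) '' CommonNbrs a Y y v := by
    rw [Finset.coe_filter]
    ext w'
    constructor
    · rintro ⟨hw'T, hne, hdist⟩
      have hw'T' : w' ∈ (fun w : E3 => a⁻¹ • (w - y)) '' {w ∈ Y | w ≠ y ∧ dist y w ≤ a * (1 + 1 / 50)} := by
        rw [← hT]; exact hw'T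
      simp only [Set.mem_image, Set.mem_setOf_eq] at hw'T'
      obtain ⟨w, ⟨hw, hwy, hdw⟩, rfl⟩ := hw'T'
      refine ⟨w, ⟨hw, hwy, ?_, hdw, ?_⟩, rfl⟩
      · intro h; apply hne; rw [h]
      · rw [dist_rescale ha, inv_mul_le_iff₀ ha] at hdist
        linarith
    · rintro ⟨w, ⟨hw, hwy, hwv, hdw, hdvw⟩, rfl⟩
      refine ⟨?_, ?_, ?_⟩
      · show a⁻¹ • (w - y) ∈ (↑T : Set E3)
        rw [hT]
        exact ⟨w, ⟨hw, hwy, hdw⟩, rfl⟩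
      · intro h; exact hwv (hfinj h)
      · show dist (a⁻¹ • (v - y)) (a⁻¹ • (w - y)) ≤ 1 + 1 / 50
        rw [dist_rescale ha, inv_mul_le_iff₀ ha]
        linarith
  rw [← Set.ncard_coe_finset, key, Set.ncard_image_of_injective _ hfinj]

/-- TYPING IN SITU: at a site all of whose bonds have EXACTLY four common neighbours,
`ShellTrichotomy` leaves only branch (A): the rescaled shell is `1/5`-close to fcc or hcp.
(Branches (B) `≥ 5` and (C) `≤ 3` are read through the degree dictionary.) PROVED. -/
theorem fccHcpShell_of_fourRegular (hST : ShellTrichotomy) {Y : Set E3} {a : ℝ} (ha : 0 < a)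
    (hgood : ∀ y ∈ Y, GappedTwelve a Y y) {y : E3} (hy : y ∈ Y)
    (h4 : ∀ v ∈ Y, v ≠ y → dist y v ≤ a * (1 + 1 / 50) → (CommonNbrs a Y y v).ncard = 4) :
    FccHcpShell a Y y := by
  classical
  obtain ⟨T, hT, hcard, hnorm, hpair⟩ := rescaledShell_hyps ha hgood hy
  refine ⟨T, hT, ?_⟩
  -- a shell point `v' ∈ T` comes from a bond `(y, v)`
  have hpre : ∀ v' ∈ T, ∃ v ∈ Y, v ≠ y ∧ dist y v ≤ a * (1 + 1 / 50) ∧ v' = a⁻¹ • (v - y) := by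
    intro v' hv'
    have hv'T : v' ∈ (↑T : Set E3) := hv'
    rw [hT] at hv'T
    obtain ⟨v, ⟨hv, hvy, hdv⟩, rfl⟩ := hv'T
    exact ⟨v, hv, hvy, hdv, rfl⟩
  rcases hST T hcard hnorm hpair with hA | hA | hB | hC
  · exact Or.inl hA
  · exact Or.inr hA
  · exfalso
    obtain ⟨v', hv', h5⟩ := hB
    obtain ⟨v, hv, hvy, hdv, rfl⟩ := hpre v' hv'
    rw [shellDegree_eq_commonNbrs ha hT hv hvy hdv, h4 v hv hvy hdv] at h5
    omega
  · exfalso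
    obtain ⟨v', hv', h3⟩ := hC
    obtain ⟨v, hv, hvy, hdv, rfl⟩ := hpre v' hv'
    rw [shellDegree_eq_commonNbrs ha hT hv hvy hdv, h4 v hv hvy hdv] at h3
    omega

/-- **THE SPLICE LEMMA (first lemma of card `rationing-splice`)**: the repaired antecedents give
the alphabet-free rationing — `TornFree` bounds every common-neighbour count below by `4`,
`FiveFoldRationingR` bounds it above by `4` on balls of every radius, and in those balls the
trichotomy types every shell fcc/hcp. PROVED. -/
theorem gappedRationing_of_trichotomy (hST : ShellTrichotomy) (hTF : TornFree)
    (hFFR : FiveFoldRationingR) : GappedRationing := by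
  intro Y a ha hne hgood R
  have htf : ∀ y ∈ Y, ∀ v ∈ Y, v ≠ y → dist y v ≤ a * (1 + 1 / 50) → 4 ≤ (CommonNbrs a Y y v).ncard :=
    hTF Y a ha (fun y hy => hgood y hy)
  obtain ⟨c, hc, hcR⟩ := hFFR Y a ha hne (fun y hy => hgood y hy) htf R
  refine ⟨c, hc, fun y hy hyc => fccHcpShell_of_fourRegular hST ha hgood hy fun v hv hvy hdv => ?_⟩
  exact le_antisymm (hcR y hy hyc v hv hvy hdv) (htf y hy v hv hvy hdv)

/-- **THE CRUX BY NAME** (`GappedShellCensus.CleanLimitExtractionR`, stmt-AtomisticToContinuum-18072), Line A: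
the splice `gappedRationing_of_trichotomy` fed into ideator 2's hull extraction `cleanLimitExtraction_via_hull`.
PROVED, sorry-free. -/
theorem cleanLimitExtractionR_candidateA : CleanLimitExtractionR :=
  fun hRDV hST hTF hFFR => cleanLimitExtraction_via_hull (gappedRationing_of_trichotomy hST hTF hFFR) hRDV

end Summit.AtomisticToContinuum.Crystallization.Cruxes.CleanLimitExtractionR.CandidateA

end
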